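import Mathlib
import HarnessLib
import Summits.ABC.ABC.Theses.RibetTakahashiSplit

/-!
# Sketch — crux-ideate stmt-ABC-15174 (ManyPrimeValuationProductSemistableFrey), round 1, ideator 2

First-lemma signatures for the crux idea card `waldspurger-cm-ledger`
("Waldspurger turns the CM line's missing factor `N` into a first moment of central values").

Contents (statements are `Prop`-valued over existing declarations; the two `theorem`s are the
kernel-checked bookkeeping of the card's ledger, pure real arithmetic):

* `valProd`, `IsAdmissibleSet` — `T(E)` and Pasten-admissible even sets `D` (Thm 6.1 (b.1):
  `N` squarefree, `M = N / ∏ D` not prime);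
* `FactorisationBoundMSF θ μ` — the typed per-factorisation shadow on the SEMISTABLE FREY class:
  `∏_{p ∈ D} ord_p Δ_min ≤ C_ε · N^{θ+ε} · M^{μ}`;
* `FactorisationGlueSF` — exponent `(0,0)` for admissible sets ⇒ the crux (elementary covering,
  provable now);
* the rung ladder `PastenRung` (8/3, 1) ⊇ `ConvexityRung` (5/2, 1) ⊇ `LindelofRung` (5/3, 1) ⊇
  `SmallDiscriminantRung` (1, 1) ⊇ `SharpKSRung` (1, 0) ⊇ crux (0, 0);
* `HeegnerLedger` + `HeegnerLedger.log_valProd_le` — the card's ledger: three exact identities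
  (Ribet–Takahashi–Pasten; Waldspurger–Plancherel over `Cl_K`; Arakelov degree at a Heegner orbit,
  Pasten Prop 14.2 + Thm 13.2) and AM–GM give
  `log T_D ≤ log avgL + 2 h_Ar + 2·KS_M + log κ − (slack) + junk`, PROVED by `linarith`.
-/

namespace Summit.ABC.ABC.Cruxes.ManyPrimeValuationProductSemistableFrey.Ideas

open scoped BigOperators Classical
open Summit.ABC.ABC.Theses.RibetTakahashiSplit

/-- `T(E) = ∏_{p ∥ N} ord_p(Δ_min)`, exactly as inlined in the route file. -/
noncomputable def valProd (W : WeierstrassCurve ℚ) : ℕ :=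
  ∏ p ∈ (W.conductorNorm ℤ).primeFactors with ¬ p ^ 2 ∣ W.conductorNorm ℤ,
    (W.minimalDiscriminantNorm ℤ).factorization p

/-- The semistable Frey class of the crux (hypotheses copied verbatim from
`ManyPrimeValuationProductSemistableFrey`): `p² ∤ N` for every prime `p`, and `W` is ℚ-isomorphic to a
twisted Frey–Hellegouarch curve `freyCurve (d a) (d b)` with `d ∣ 2`. -/
def InClass (W : WeierstrassCurve ℚ) : Prop :=
  (∀ p : ℕ, p.Prime → ¬ p ^ 2 ∣ W.conductorNorm ℤ) ∧
  (∃ (a b d : ℤ) (C' : WeierstrassCurve.VariableChange ℚ), IsCoprime a b ∧ a * b * (a + b) ≠ 0 ∧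
    d ∣ 2 ∧ C' • W = Literature.NumberTheory.EllipticCurves.freyCurve (d * a) (d * b))

/-- Pasten-admissible even set of multiplicative primes (arXiv:1705.09251 Thm 6.1 (b.1) / Thm 1.5 (i)
for SQUAREFREE `N`): `D ⊆` prime factors of `N`, `|D|` even and `≥ 2`, and the Eichler level
`M = N / ∏_{p ∈ D} p` is not a prime number. -/
def IsAdmissibleSet (W : WeierstrassCurve ℚ) (D : Finset ℕ) : Prop :=
  D ⊆ (W.conductorNorm ℤ).primeFactors ∧ Even D.card ∧ 2 ≤ D.card ∧
    ¬ (W.conductorNorm ℤ / ∏ p ∈ D, p).Prime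

/-- The typed per-factorisation shadow with conductor exponent `θ` and Eichler-level exponent `μ`:
for `W` in the semistable Frey class and every admissible `D`,
`∏_{p ∈ D} ord_p Δ_min ≤ C_ε · N^{θ+ε} · M^{μ}`, `M = N / ∏ D`.
Pasten Thm 16.4 (i) is `(θ, μ) = (8/3, 1)`; the card's ledger gives `(5/2, 1)` at convexity and the
ladder below; the crux is `(0, 0)` glued over ≤ 3 admissible sets. -/
def FactorisationBoundMSF (θ μ : ℝ) : Prop :=
  ∀ ε : ℝ, 0 < ε → ∃ C : ℝ, ∀ (W : WeierstrassCurve ℚ) [W.IsElliptic], InClass W →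
    ∀ D : Finset ℕ, IsAdmissibleSet W D →
      ((∏ p ∈ D, (W.minimalDiscriminantNorm ℤ).factorization p : ℕ) : ℝ) ≤
        C * (W.conductorNorm ℤ : ℝ) ^ (θ + ε) *
          ((W.conductorNorm ℤ / ∏ p ∈ D, p : ℕ) : ℝ) ^ μ

/-- FIRST LEMMA (provable now, elementary covering): on the class, `N` is squarefree with `s ≥ 4`
prime factors; `s` even ⇒ the single set `D = all primes of N`, `M = 1` (Pasten's choice in the proof
of Thm 16.5); `s` odd ≥ 7 ⇒ `all ∖ {p₁,p₂,p₃}` (`M = p₁p₂p₃`) plus `{p₁,p₂,p₃,p₄}` (`ω(M) = s − 4 ≥ 3`);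
`s = 5` ⇒ the three pairs `{p₄,p₅}, {p₁,p₂}, {p₃,p₄}` (`ω(M) = 3` each); every `M` is `1` or has ≥ 2
prime factors, and `T ≤ ∏_i T_{D_i}` since every factor is `≥ 1` (`ord_p Δ_min ≥ 1` at `p ∣ N`).
With `μ = 0` the `M`-factor is absent, so exponent `(0,0)` gives the crux. -/
def FactorisationGlueSF : Prop :=
  FactorisationBoundMSF 0 0 → ManyPrimeValuationProductSemistableFrey

/-- Rung R0 (in print): Pasten arXiv:1705.09251 Thm 16.4 (i) restricted to the class. -/
def PastenRung : Prop := FactorisationBoundMSF (8 / 3) 1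

/-- Rung R1 (this card, unconditional modulo the normalisation stub of the explicit Waldspurger
formula, Cai–Shu–Tian Thm 1.8): convexity for `L(1/2, f_E × θ_{χ₀ψ})` in the `N`- and `d`-aspects +
Pasten's counting of Heegner fields (`d ≤ 2N^{2/3+δ}`) + Prop 14.2 as printed:
`T_D ≤ N^{1 + 1/2 + (2/3)(1 + 1/2) + o(1)} · M = N^{5/2+o(1)} M`. -/
def ConvexityRung : Prop := FactorisationBoundMSF (5 / 2) 1

/-- Rung R2: R1 with the Lindelöf hypothesis for the family `L(1/2, f_E × θ_{χ₀ψ})` (a consequence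
of GRH) in both aspects: `T_D ≤ N^{1 + 0 + 2/3 + o(1)} M`. -/
def LindelofRung : Prop := FactorisationBoundMSF (5 / 3) 1

/-- Rung R3: R2 plus non-vanishing of `f_{D,M}` on ONE admissible Heegner orbit of discriminant
`d ≤ N^{o(1)}` (equivalently `L(1/2, f_E × θ_{χ₀ψ}) ≠ 0` for some `ψ ∈ Ĉl_{-d}`): `T_D ≤ N^{1+o(1)} M`. -/
def SmallDiscriminantRung : Prop := FactorisationBoundMSF 1 1

/-- Rung R4: R3 plus the sharp Kodaira–Spencer term at `p ∣ M` (`KS_M = o(log N)` on the orbit,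
Atkin–Lehner orientation symmetry): `T_D ≤ N^{1+o(1)}` — the intrinsic floor `log(dD)` of every
CM-value certificate (Pasten Thm 13.2: `h_Ar(P_K) = ½ log(d_K D) + L'/L(1,χ) − γ − log 2π`). -/
def SharpKSRung : Prop := FactorisationBoundMSF 1 0

/-- The ladder is monotone in the obvious sense (each rung implies the previous one); recorded as
statements for the crux-plan. -/
def LadderMonotone : Prop :=
  (SharpKSRung → SmallDiscriminantRung) ∧ (SmallDiscriminantRung → LindelofRung) ∧
    (LindelofRung → ConvexityRung) ∧ (ConvexityRung → PastenRung)

/-! ### The ledger (kernel-checked bookkeeping of the card)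

All quantities are real logarithms attached to ONE admissible factorisation `N = D·M` of a curve in
the class, ONE `(D,M)`-Heegner field `K = ℚ(√-d)` and the Galois orbit `O` of its Heegner point:
* `logT`    = `log ∏_{p ∣ D} ord_p Δ_min`;
* `logPet`  = `log (f,f)_{Γ₀(N)}` (q-normalised newform), `logNorm` = `log ‖f_{D,M}‖²_{Pet}`
  (Pasten's integral pull-back of the Néron differential, §16), `logVol` = `log vol(X_0^D(M))`,
  `logLad` = `log L(1, Ad f)`;
* `logMeanSq` = `log` of the orbit mean of `‖f_{D,M}‖²_{pt}`;
* `logR` = `log` of the orbit mean of `|F|²` for the probability-normalised `F`;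
* `logAvgL` = `log` of `(1/h) ∑_ψ L(1/2, f × θ_{χ₀ψ})`, `logKappa` = the explicit constant of the
  Waldspurger formula (Cai–Shu–Tian Thm 1.8) incl. `√d / h`;
* `hAr` = Pasten's Arakelov height of the Heegner point (Thm 13.2), `ks` = the Kodaira–Spencer
  index term at `p ∣ M` (`≤ log 2M`, Prop 14.2), `slack` = `2V + Def_orbit ≥ 0` (finite proximity of
  the orbit to `div f_{D,M}` plus the AM/GM gap on the orbit).
-/

/-- The ledger datum: the hypotheses are the three identities and two inequalities of the card. -/
structure HeegnerLedger where
  (logT logPet logNorm logVol logLad logMeanSq logR logAvgL logKappa hAr ks slack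
    junkRT junkVol : ℝ)
  /-- (L0) Ribet–Takahashi–Pasten: `log T_D = log(f,f) − log‖f_{D,M}‖² + O(log D / log log D)`. -/
  rt : logT ≤ logPet - logNorm + junkRT
  /-- `(f,f)/vol ≍ L(1, Ad f)` (Rankin–Selberg unfolding; vol(X_0^D(M)) ≍ vol(X_0(N)) · N^{o(1)}). -/
  petVol : logPet - logVol ≤ logLad + junkVol
  /-- (L1a) definition of the probability normalisation: `‖f‖²_{Pet} = vol · meanSq / R`. -/
  probNorm : logNorm = logVol + logMeanSq - logR
  /-- (L1b) Waldspurger–Plancherel over `Cl_K` (Cai–Shu–Tian Thm 1.8): `R = κ · avgL / L(1, Ad f)`. -/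
  waldspurger : logR = logKappa + logAvgL - logLad
  /-- (L2)+(L3) AM–GM on the orbit and the Arakelov degree at the Heegner orbit (Pasten Prop 14.2,
  exact form): `log meanSq = meanLog + Def`, `meanLog = −2 hAr − 2 ks + 2 V`, `slack = 2V + Def ≥ 0`. -/
  arakelov : logMeanSq = -2 * hAr - 2 * ks + slack
  slack_nonneg : 0 ≤ slack

/-- THE LEDGER INEQUALITY (card, §Lever): per admissible factorisation and Heegner orbit,
`log T_D ≤ log avg_ψ L(1/2, f × θ_{χ₀ψ}) + 2 h_Ar(P_K) + 2 KS_M + log κ − slack + junk`.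
With `2 h_Ar = log(dD) + O(log log d)` (Pasten Thm 13.2) and `KS_M ≤ log 2M` (Prop 14.2) this is
`log T_D ≤ log avgL + log N + log M + log d + …`, i.e. the rungs above. [folklore] -/
theorem HeegnerLedger.log_valProd_le (L : HeegnerLedger) :
    L.logT ≤ L.logAvgL + 2 * L.hAr + 2 * L.ks + L.logKappa - L.slack + (L.junkRT + L.junkVol) := by
  have h1 := L.rt
  have h2 := L.petVol
  have h3 := L.probNorm
  have h4 := L.waldspurger
  have h5 := L.arakelov
  linarith

/-- The same ledger read at convexity: if `log avgL ≤ (1/2 + ε) log N + c · log d` (convexity bound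
for `L(1/2, f × θ_{χ₀ψ})`, analytic conductor `≍ (N d)²`) then
`log T_D ≤ (1/2 + ε) log N + 2 h_Ar + 2 ks + …` — bookkeeping only. [folklore] -/
theorem HeegnerLedger.log_valProd_le_of_convexity (L : HeegnerLedger) {logN logd ε c : ℝ}
    (hconv : L.logAvgL ≤ (1 / 2 + ε) * logN + c * logd) :
    L.logT ≤ (1 / 2 + ε) * logN + c * logd + 2 * L.hAr + 2 * L.ks + L.logKappa
      + (L.junkRT + L.junkVol) := by
  have h := L.log_valProd_le
  have hs := L.slack_nonneg
  linarith

end Summit.ABC.ABC.Cruxes.ManyPrimeValuationProductSemistableFrey.Ideas
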